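import Literature.NumberTheory.Irrationality.RivoalZudilin2020.TwoIrrationalOddZetaValues
import Literature.NumberTheory.LFunctions.RHWave0PNTProofs
import HarnessLib

/-!
# Rivoal–Zudilin 2020, §6: `log(Φ_n)/n → δ ≈ 1.29564` (proof of the named fact `log_phi_div_tendsto`)

Topic `Literature/NumberTheory/Irrationality/RivoalZudilin2020`; proofs-only companion of
`TwoIrrationalOddZetaValues.lean`. Source: T. Rivoal, W. Zudilin, *A note on odd zeta values*, Sém. Lothar.
Combin. **81** (2020) B81b, §6 (arXiv:1803.03160 p. 10): "the asymptotic behaviors of `d_n` and of `Φ_n` both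
follow from the prime number theorem: … `δ := lim log(Φ_n)/n = ∫₀¹ ρ₀(t) d(ψ(t) + t⁻¹) ≈ 1.29564`", where
`Φ_n = ∏_{2√n < p ≤ n} p^{ρ₀(n/p)}` (`Phi`) and `ρ₀ = 0, 1, 2, 3, 4` on `[0,⅓), [⅓,½), [½,⅔), [⅔,⅚), [⅚,1)` mod 1
(`rho0`). The typed fact: the limit `δ` exists and `1.2956 < δ < 1.2957`.

Proof (the printed "follows from the prime number theorem", made explicit).
`ρ₀ = 𝟙[{x} ≥ ⅓] + 𝟙[{x} ≥ ½] + 𝟙[{x} ≥ ⅔] + 𝟙[{x} ≥ ⅚]`; for a prime `p ≤ n` with `⌊n/p⌋ = k` and a mark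
`0 < a < 1`, `{n/p} ≥ a ⇔ n/(k+1) < p ≤ n/(k+a)`. So the primes `p > n/(K+1)` contribute
`M_K(n) = Σ_a Σ_{k ≤ K} (ϑ(n/(k+a)) − ϑ(n/(k+1)))` (`ϑ` = Mathlib's `Chebyshev.theta`), and for `n ≥ 4(K+1)²`
the others (`2√n < p ≤ n/(K+1)`) between `0` and `4ϑ(n/(K+1)) ≤ 4 log 4 · n/(K+1)`
(`Chebyshev.theta_le_log4_mul_x`). By `ϑ(x) ~ x` (tree, PROVED:
`Literature.NumberTheory.LFunctions.chebyshevTheta_isEquivalent`) `M_K(n)/n → δ_K = Σ_a Σ_{k ≤ K} (1/(k+a) − 1/(k+1))`,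
and `K → ∞` gives `δ = Σ_{k ≥ 1} Σ_{a ∈ {⅓,½,⅔,⅚}} (1/(k+a) − 1/(k+1))` — the printed Stieltjes integral, as
`d(ψ(t) + t⁻¹) = Σ_{k ≥ 1} (k+t)⁻² dt`. The window by exact rationals: twelve terms of each series and the
telescoping tail bounds `(1−a)/(13 + c_a) ≤ Σ_{k ≥ 13} (1−a)/((k+a)(k+1)) ≤ (1−a)/(13 + a/2)`,
`c_a = a/2 + a(2−a)/104`, placing `δ` in `[1.29562, 1.29569]`.

All helpers are private theorems (no definitions); the only public declaration is `log_phi_div_tendsto_holds`.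
-/

open Finset Filter Topology Asymptotics

noncomputable section

namespace Literature.NumberTheory.Irrationality.RivoalZudilin2020

/-- The series of one mark `0 ≤ a < 1`: `t_i = 1/(i+1+a) − 1/(i+2) = (1−a)/((i+1+a)(i+2)) ≥ 0` is summable, and
twelve terms plus the telescoping tail bounds `(1−a)/(13 + c_a) ≤ Σ_{i ≥ 12} t_i ≤ (1−a)/(13 + a/2)`,
`c_a = a/2 + a(2−a)/104` (from `(k + a/2)(k+1+a/2) ≤ (k+a)(k+1) ≤ (k + c_a)(k + 1 + c_a)` for `k ≥ 13`), enclose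
its sum. [folklore] -/
private theorem mark_series {a : ℝ} (ha : 0 ≤ a) (ha1 : a < 1) :
    Summable (fun i : ℕ => (1 / ((i : ℝ) + 1 + a) - 1 / ((i : ℝ) + 2))) ∧
      ∑ i ∈ range 12, (1 / ((i : ℝ) + 1 + a) - 1 / ((i : ℝ) + 2)) + (1 - a) / (13 + (a / 2 + a * (2 - a) / 104)) ≤
          ∑' i : ℕ, (1 / ((i : ℝ) + 1 + a) - 1 / ((i : ℝ) + 2)) ∧
      ∑' i : ℕ, (1 / ((i : ℝ) + 1 + a) - 1 / ((i : ℝ) + 2)) ≤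
          ∑ i ∈ range 12, (1 / ((i : ℝ) + 1 + a) - 1 / ((i : ℝ) + 2)) + (1 - a) / (13 + a / 2) := by
  set t : ℕ → ℝ := fun i => (1 / ((i : ℝ) + 1 + a) - 1 / ((i : ℝ) + 2)) with ht
  have hteq : ∀ i : ℕ, t i = (1 - a) / (((i : ℝ) + 1 + a) * ((i : ℝ) + 2)) := fun i => by
    simp only [ht]
    rw [div_sub_div _ _ (by positivity) (by positivity)]
    exact congrArg₂ (· / ·) (by ring) rfl
  have h0 : ∀ i, 0 ≤ t i := fun i => by rw [hteq]; exact div_nonneg (by linarith) (by positivity)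
  -- summability by comparison with `Σ 1/k²`
  have hsum : Summable t := by
    have h : Summable fun i : ℕ => 1 / ((i : ℝ) + 1) ^ 2 := by
      simpa using (summable_nat_add_iff 1).2 (Real.summable_one_div_nat_pow.2 one_lt_two)
    refine Summable.of_nonneg_of_le h0 (fun i => ?_) h
    rw [hteq, div_le_div_iff₀ (by positivity) (by positivity)]
    have hi : (0 : ℝ) ≤ i := i.cast_nonneg
    nlinarith [mul_nonneg hi ha, mul_nonneg hi hi]
  have hsum12 : Summable fun i => t (i + 12) := (summable_nat_add_iff 12).2 hsum
  rw [← hsum.sum_add_tsum_nat_add 12]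
  -- the telescoping sequences `v_c i = (1−a)/(i+13+c)` and their steps
  set v : ℝ → ℕ → ℝ := fun c i => (1 - a) / ((i : ℝ) + 13 + c) with hv
  have hstep : ∀ c : ℝ, 0 ≤ c → ∀ i : ℕ,
      v c i - v c (i + 1) = (1 - a) / (((i : ℝ) + 13 + c) * ((i : ℝ) + 14 + c)) := by
    intro c hc i
    simp only [hv, Nat.cast_add, Nat.cast_one]
    rw [div_sub_div _ _ (by positivity) (by positivity)]; exact congrArg₂ (· / ·) (by ring) (by ring)
  have hterm : ∀ i : ℕ, t (i + 12) = (1 - a) / (((i : ℝ) + 13 + a) * ((i : ℝ) + 14)) := by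
    intro i; rw [hteq, Nat.cast_add]; exact congrArg₂ (· / ·) rfl (by push_cast; ring)
  have htel : ∀ c : ℝ, ∀ n : ℕ, ∑ i ∈ range n, (v c i - v c (i + 1)) = v c 0 - v c n := fun c n =>
    Finset.sum_range_sub' _ n
  have hd : 0 ≤ a * (2 - a) / 104 := by nlinarith
  refine ⟨hsum, add_le_add le_rfl ?_, add_le_add le_rfl ?_⟩
  · -- lower tail bound: partial sums dominate `v_c 0 − v_c n → v_c 0`
    set c := a / 2 + a * (2 - a) / 104 with hc
    have hc0 : 0 ≤ c := by rw [hc]; positivity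
    have hle : ∀ i : ℕ, v c i - v c (i + 1) ≤ t (i + 12) := by
      intro i
      rw [hstep c hc0, hterm]
      apply div_le_div_of_nonneg_left (by linarith) (by positivity)
      have hi : (0 : ℝ) ≤ i := i.cast_nonneg
      have key : ((i : ℝ) + 13 + c) * ((i : ℝ) + 14 + c) - ((i : ℝ) + 13 + a) * ((i : ℝ) + 14) =
          a * (2 - a) / 104 * (2 * (i : ℝ) + 1 + a + a * (2 - a) / 104) := by rw [hc]; ring
      nlinarith [mul_nonneg hd (by positivity : (0 : ℝ) ≤ 2 * (i : ℝ) + 1 + a + a * (2 - a) / 104)]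
    have hpart : ∀ n : ℕ, v c 0 - v c n ≤ ∑' i, t (i + 12) := fun n =>
      (htel c n).symm.le.trans ((sum_le_sum fun i _ => hle i).trans (hsum12.sum_le_tsum (range n) fun i _ => h0 _))
    have hlim : Tendsto (fun n : ℕ => v c 0 - v c n) atTop (𝓝 (v c 0 - 0)) :=
      tendsto_const_nhds.sub (tendsto_const_nhds.div_atTop
        (tendsto_atTop_add_const_right _ _ (tendsto_atTop_add_const_right _ _ tendsto_natCast_atTop_atTop)))
    have hv0 : v c 0 = (1 - a) / (13 + c) := by simp [hv]
    rw [sub_zero] at hlim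
    exact hv0 ▸ le_of_tendsto' hlim hpart
  · -- upper tail bound: partial sums are at most `v_{a/2} 0`
    have hle : ∀ i : ℕ, t (i + 12) ≤ v (a / 2) i - v (a / 2) (i + 1) := by
      intro i
      rw [hstep (a / 2) (by positivity), hterm]
      apply div_le_div_of_nonneg_left (by linarith) (by positivity)
      nlinarith
    refine Real.tsum_le_of_sum_range_le (fun i => h0 _) fun n => ?_
    calc ∑ i ∈ range n, t (i + 12) ≤ v (a / 2) 0 - v (a / 2) n := (sum_le_sum fun i _ => hle i).trans (htel _ n).le
      _ ≤ v (a / 2) 0 := sub_le_self _ (div_nonneg (by linarith) (by positivity))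
      _ = (1 - a) / (13 + a / 2) := by simp [hv]

/-- `ρ₀(x) = 𝟙[{x} ≥ ⅓] + 𝟙[{x} ≥ ½] + 𝟙[{x} ≥ ⅔] + 𝟙[{x} ≥ ⅚]`. [folklore] -/
private theorem rho0_eq_sum_ind (x : ℝ) :
    (rho0 x : ℝ) = (if 1 / 3 ≤ Int.fract x then (1 : ℝ) else 0) + (if 1 / 2 ≤ Int.fract x then (1 : ℝ) else 0) +
      (if 2 / 3 ≤ Int.fract x then (1 : ℝ) else 0) + (if 5 / 6 ≤ Int.fract x then (1 : ℝ) else 0) := by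
  unfold rho0
  rcases lt_or_ge (Int.fract x) (1 / 3) with h3 | h3
  · rw [if_pos h3, if_neg (by linarith), if_neg (by linarith), if_neg (by linarith), if_neg (by linarith)]
    norm_num
  rcases lt_or_ge (Int.fract x) (1 / 2) with h2 | h2
  · rw [if_neg (not_lt.2 h3), if_pos h2, if_pos h3, if_neg (by linarith), if_neg (by linarith), if_neg (by linarith)]
    norm_num
  rcases lt_or_ge (Int.fract x) (2 / 3) with h4 | h4
  · rw [if_neg (not_lt.2 h3), if_neg (not_lt.2 h2), if_pos h4, if_pos h3, if_pos h2, if_neg (by linarith), if_neg (by linarith)]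
    norm_num
  rcases lt_or_ge (Int.fract x) (5 / 6) with h5 | h5
  · rw [if_neg (not_lt.2 h3), if_neg (not_lt.2 h2), if_neg (not_lt.2 h4), if_pos h5, if_pos h3, if_pos h2, if_pos h4, if_neg (by linarith)]
    norm_num
  · rw [if_neg (not_lt.2 h3), if_neg (not_lt.2 h2), if_neg (not_lt.2 h4), if_neg (not_lt.2 h5), if_pos h3, if_pos h2, if_pos h4, if_pos h5]
    norm_num

/-- `ρ₀ ≤ 4`. [folklore] -/
private theorem rho0_le_four (x : ℝ) : (rho0 x : ℝ) ≤ 4 := by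
  unfold rho0
  split_ifs <;> norm_num

/-- For `0 ≤ y ≤ n`: `ϑ(y) = Σ_{p ≤ n prime} 𝟙[p ≤ y] log p`. [folklore] -/
private theorem theta_eq_sum_ite (n : ℕ) {y : ℝ} (hy0 : 0 ≤ y) (hyn : y ≤ n) :
    Chebyshev.theta y = ∑ p ∈ (Ioc 0 n).filter Nat.Prime, if (p : ℝ) ≤ y then Real.log p else 0 := by
  rw [Chebyshev.theta, ← Finset.sum_filter]
  refine Finset.sum_congr ?_ fun _ _ => rfl
  ext p; simp only [mem_filter, mem_Ioc]; constructor
  · rintro ⟨⟨hp0, hpy⟩, hp⟩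
    have hpy' : (p : ℝ) ≤ y := (Nat.le_floor_iff hy0).1 hpy
    exact ⟨⟨⟨hp0, by exact_mod_cast hpy'.trans hyn⟩, hp⟩, hpy'⟩
  · rintro ⟨⟨⟨hp0, -⟩, hp⟩, hpy⟩
    exact ⟨⟨hp0, (Nat.le_floor_iff hy0).2 hpy⟩, hp⟩

/-- One block (`k = i + 1`): `ϑ(n/(k+a)) − ϑ(n/(k+1)) = Σ_{p ≤ n prime} 𝟙[n/(k+1) < p ≤ n/(k+a)] log p`.
[folklore] -/
private theorem theta_sub_theta_eq (n i : ℕ) {a : ℝ} (ha0 : 0 < a) (ha1 : a < 1) :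
    Chebyshev.theta (n / ((i : ℝ) + 1 + a)) - Chebyshev.theta (n / ((i : ℝ) + 2)) =
      ∑ p ∈ (Ioc 0 n).filter Nat.Prime,
        if (n : ℝ) / ((i : ℝ) + 2) < p ∧ (p : ℝ) ≤ n / ((i : ℝ) + 1 + a) then Real.log p else 0 := by
  have hn : (0 : ℝ) ≤ n := n.cast_nonneg
  have hi : (0 : ℝ) ≤ i := i.cast_nonneg
  have hmono : (n : ℝ) / ((i : ℝ) + 2) ≤ n / ((i : ℝ) + 1 + a) :=
    div_le_div_of_nonneg_left hn (by positivity) (by linarith)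
  rw [theta_eq_sum_ite n (by positivity) (div_le_self hn (by linarith)),
    theta_eq_sum_ite n (by positivity) (div_le_self hn (by linarith)), ← Finset.sum_sub_distrib]
  refine Finset.sum_congr rfl fun p _ => ?_
  by_cases c2 : (p : ℝ) ≤ n / ((i : ℝ) + 2)
  · rw [if_pos (c2.trans hmono), if_pos c2, if_neg (fun h => (not_lt.2 c2) h.1), sub_self]
  · by_cases c1 : (p : ℝ) ≤ n / ((i : ℝ) + 1 + a)
    · rw [if_pos c1, if_neg c2, if_pos ⟨not_le.1 c2, c1⟩, sub_zero]
    · rw [if_neg c1, if_neg c2, if_neg (fun h => c1 h.2), sub_zero]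

/-- For `x ≥ 1`, `a ≥ 0`: `Σ_{k=1}^{K} 𝟙[k + a ≤ x < k+1] = 𝟙[x < K+1 ∧ a ≤ {x}]`. [folklore] -/
private theorem sum_indicator_floor {x a : ℝ} (hx1 : 1 ≤ x) (ha0 : 0 ≤ a) (K : ℕ) :
    ∑ i ∈ range K, (if (i : ℝ) + 1 + a ≤ x ∧ x < (i : ℝ) + 2 then (1 : ℝ) else 0) =
      if x < K + 1 ∧ a ≤ Int.fract x then 1 else 0 := by
  have hx0 : 0 ≤ x := by linarith
  set m := ⌊x⌋₊ with hm
  have hxm : x < m + 1 := Nat.lt_floor_add_one x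
  have hfract : Int.fract x = x - m := by rw [Int.fract, hm, natCast_floor_eq_intCast_floor hx0]
  have hm1 : 1 ≤ m := (Nat.one_le_floor_iff x).2 hx1
  have key : ∀ i : ℕ, ((i : ℝ) + 1 + a ≤ x ∧ x < (i : ℝ) + 2) ↔ (i = m - 1 ∧ a ≤ Int.fract x) := by
    intro i
    constructor
    · rintro ⟨h1, h2⟩
      have hk : ⌊x⌋₊ = i + 1 := by rw [Nat.floor_eq_iff hx0]; push_cast; exact ⟨by linarith, by linarith⟩
      refine ⟨by omega, ?_⟩
      rw [hfract, hm, hk]; push_cast; linarith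
    · rintro ⟨hi, h2⟩
      have hi' : m = i + 1 := by omega
      rw [hfract, hi'] at h2; rw [hi'] at hxm; push_cast at h2 hxm
      exact ⟨by linarith, by linarith⟩
  simp_rw [key, ite_and]
  rw [Finset.sum_ite_eq']
  have hmem : m - 1 ∈ range K ↔ x < K + 1 := by
    rw [mem_range, show (m - 1 < K ↔ m < K + 1) by omega, hm, Nat.floor_lt hx0]; push_cast; exact Iff.rfl
  by_cases hK : x < K + 1
  · simp [hmem.2 hK, hK]
  · simp [mt hmem.1 hK, hK]

/-- The block sum of one mark: `Σ_{k ≤ K} (ϑ(n/(k+a)) − ϑ(n/(k+1))) = Σ_{n/(K+1) < p ≤ n} 𝟙[{n/p} ≥ a] log p`.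
[folklore] -/
private theorem blockT_eq (n K : ℕ) {a : ℝ} (ha0 : 0 < a) (ha1 : a < 1) :
    ∑ i ∈ range K, (Chebyshev.theta (n / ((i : ℝ) + 1 + a)) - Chebyshev.theta (n / ((i : ℝ) + 2))) =
      ∑ p ∈ (Ioc 0 n).filter Nat.Prime,
        if (n : ℝ) / (K + 1) < p then (if a ≤ Int.fract ((n : ℝ) / p) then (1 : ℝ) else 0) * Real.log p else 0 := by
  rw [Finset.sum_congr rfl fun i _ => theta_sub_theta_eq n i ha0 ha1, Finset.sum_comm]
  refine Finset.sum_congr rfl fun p hp => ?_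
  obtain ⟨⟨hp0, hpn⟩, -⟩ : (0 < p ∧ p ≤ n) ∧ p.Prime := by simpa [mem_filter, mem_Ioc] using hp
  have hp : (0 : ℝ) < p := by exact_mod_cast hp0
  have hx1 : (1 : ℝ) ≤ n / p := by rw [le_div_iff₀ hp, one_mul]; exact_mod_cast hpn
  -- `n/c < p ⇔ n/p < c` and `p ≤ n/c ⇔ c ≤ n/p`
  have e1 : ∀ c : ℝ, 0 < c → ((n : ℝ) / c < p ↔ (n : ℝ) / p < c) := fun c hc => by rw [div_lt_iff₀ hc, div_lt_iff₀ hp, mul_comm]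
  have e2 : ∀ c : ℝ, 0 < c → ((p : ℝ) ≤ n / c ↔ c ≤ (n : ℝ) / p) := fun c hc => by rw [le_div_iff₀ hc, le_div_iff₀ hp, mul_comm]
  have hmul : ∀ i : ℕ, (if (n : ℝ) / ((i : ℝ) + 2) < p ∧ (p : ℝ) ≤ n / ((i : ℝ) + 1 + a)
      then Real.log p else 0) =
      (if (i : ℝ) + 1 + a ≤ n / p ∧ (n : ℝ) / p < (i : ℝ) + 2 then (1 : ℝ) else 0) * Real.log p := by
    intro i
    have hc : ((n : ℝ) / ((i : ℝ) + 2) < p ∧ (p : ℝ) ≤ n / ((i : ℝ) + 1 + a)) ↔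
        ((i : ℝ) + 1 + a ≤ n / p ∧ (n : ℝ) / p < (i : ℝ) + 2) := by
      rw [e1 _ (by positivity), e2 _ (by positivity), and_comm]
    by_cases h : (i : ℝ) + 1 + a ≤ n / p ∧ (n : ℝ) / p < (i : ℝ) + 2
    · rw [if_pos h, if_pos (hc.2 h), one_mul]
    · rw [if_neg h, if_neg (mt hc.1 h), zero_mul]
  simp_rw [hmul]
  rw [← Finset.sum_mul, sum_indicator_floor hx1 ha0.le K]
  by_cases h1 : (n : ℝ) / (K + 1) < p
  · rw [if_pos h1]
    by_cases h2 : a ≤ Int.fract ((n : ℝ) / p)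
    · rw [if_pos ⟨(e1 _ (by positivity)).1 h1, h2⟩, if_pos h2]
    · rw [if_neg (fun h => h2 h.2), if_neg h2]
  · rw [if_neg h1, if_neg (fun h => (mt (e1 _ (by positivity)).2 h1) h.1), zero_mul]

/-- `M_K(n) = Σ_{n/(K+1) < p ≤ n} ρ₀(n/p) log p` is the sum of the four block sums. [folklore] -/
private theorem blockM_eq (n K : ℕ) :
    ∑ p ∈ (Ioc 0 n).filter Nat.Prime, (if (n : ℝ) / (K + 1) < p then (rho0 (n / p) : ℝ) * Real.log p else 0) =
      ∑ i ∈ range K, (Chebyshev.theta (n / ((i : ℝ) + 1 + 1 / 3)) - Chebyshev.theta (n / ((i : ℝ) + 2))) +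
      ∑ i ∈ range K, (Chebyshev.theta (n / ((i : ℝ) + 1 + 1 / 2)) - Chebyshev.theta (n / ((i : ℝ) + 2))) +
      ∑ i ∈ range K, (Chebyshev.theta (n / ((i : ℝ) + 1 + 2 / 3)) - Chebyshev.theta (n / ((i : ℝ) + 2))) +
      ∑ i ∈ range K, (Chebyshev.theta (n / ((i : ℝ) + 1 + 5 / 6)) - Chebyshev.theta (n / ((i : ℝ) + 2))) := by
  rw [blockT_eq n K (by norm_num) (by norm_num), blockT_eq n K (by norm_num) (by norm_num),
    blockT_eq n K (by norm_num) (by norm_num), blockT_eq n K (by norm_num) (by norm_num),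
    ← sum_add_distrib, ← sum_add_distrib, ← sum_add_distrib]
  refine sum_congr rfl fun p _ => ?_
  by_cases h : (n : ℝ) / (K + 1) < p
  · simp only [if_pos h, rho0_eq_sum_ind]; ring
  · simp only [if_neg h]; ring

/-- **Sandwich** for `n ≥ 4(K+1)²`: `M_K(n) ≤ log Φ_n ≤ M_K(n) + 4 ϑ(n/(K+1))`. [folklore] -/
private theorem sandwich (n K : ℕ) (hn : 4 * (K + 1) ^ 2 ≤ n) :
    ∑ p ∈ (Ioc 0 n).filter Nat.Prime, (if (n : ℝ) / (K + 1) < p then (rho0 (n / p) : ℝ) * Real.log p else 0) ≤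
        Real.log (Phi n) ∧
      Real.log (Phi n) ≤ ∑ p ∈ (Ioc 0 n).filter Nat.Prime,
        (if (n : ℝ) / (K + 1) < p then (rho0 (n / p) : ℝ) * Real.log p else 0) + 4 * Chebyshev.theta (n / ((K : ℝ) + 1)) := by
  have hn0 : (0 : ℝ) ≤ n := n.cast_nonneg
  have hterm : ∀ p : ℕ, 0 ≤ (rho0 ((n : ℝ) / p) : ℝ) * Real.log p := fun p =>
    mul_nonneg (Nat.cast_nonneg _) (Real.log_natCast_nonneg p)
  -- `log Φ_n = Σ_{p ≤ n prime, 4n < p²} ρ₀(n/p) log p`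
  have hlog : Real.log (Phi n) = ∑ p ∈ (Ioc 0 n).filter (fun p => p.Prime ∧ 4 * n < p * p),
      (rho0 ((n : ℝ) / p) : ℝ) * Real.log p := by
    rw [Phi, Nat.cast_prod, Real.log_prod]
    · exact sum_congr rfl fun p _ => by rw [Nat.cast_pow, Real.log_pow]
    · exact fun p hp => by have hp0 : 0 < p := (mem_Ioc.1 (mem_filter.1 hp).1).1; positivity
  rw [hlog]
  constructor
  · -- the primes `p > n/(K+1)` satisfy `4n < p²`
    rw [← sum_filter]
    refine sum_le_sum_of_subset_of_nonneg (fun p hp => ?_) fun p _ _ => hterm p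
    simp only [mem_filter, mem_Ioc] at hp ⊢
    obtain ⟨⟨⟨hp0, hpn⟩, hprime⟩, hpK⟩ := hp
    refine ⟨⟨hp0, hpn⟩, hprime, ?_⟩
    rw [div_lt_iff₀ (by positivity)] at hpK
    have hKn : (4 : ℝ) * ((K : ℝ) + 1) ^ 2 ≤ n := by exact_mod_cast hn
    have h1 : (0 : ℝ) < (p : ℝ) * ((K : ℝ) + 1) - n := by linarith
    have key : (4 : ℝ) * n < p * p := by
      nlinarith [mul_pos h1 (by positivity : (0 : ℝ) < (p : ℝ) * ((K : ℝ) + 1) + n),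
        mul_nonneg hn0 (sub_nonneg.2 hKn)]
    exact_mod_cast key
  · calc ∑ p ∈ (Ioc 0 n).filter (fun p => p.Prime ∧ 4 * n < p * p), (rho0 ((n : ℝ) / p) : ℝ) * Real.log p
        ≤ ∑ p ∈ (Ioc 0 n).filter Nat.Prime, (rho0 ((n : ℝ) / p) : ℝ) * Real.log p :=
          sum_le_sum_of_subset_of_nonneg (fun p hp => by
            simp only [mem_filter] at hp ⊢; exact ⟨hp.1, hp.2.1⟩) fun p _ _ => hterm p
      _ = ∑ p ∈ (Ioc 0 n).filter Nat.Prime, (if (n : ℝ) / (K + 1) < p then (rho0 (n / p) : ℝ) * Real.log p else 0) +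
            ∑ p ∈ (Ioc 0 n).filter Nat.Prime,
              (if ¬ ((n : ℝ) / (K + 1) < p) then (rho0 ((n : ℝ) / p) : ℝ) * Real.log p else 0) := by
          rw [← sum_add_distrib]
          refine sum_congr rfl fun p _ => ?_
          split_ifs <;> simp
      _ ≤ ∑ p ∈ (Ioc 0 n).filter Nat.Prime, (if (n : ℝ) / (K + 1) < p then (rho0 (n / p) : ℝ) * Real.log p else 0) +
            ∑ p ∈ (Ioc 0 n).filter Nat.Prime, (if (p : ℝ) ≤ n / ((K : ℝ) + 1) then 4 * Real.log p else 0) := by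
          gcongr with p hp
          by_cases h : (n : ℝ) / (K + 1) < p
          · rw [if_neg (not_not_intro h)]
            split_ifs
            · exact mul_nonneg (by norm_num) (Real.log_natCast_nonneg p)
            · exact le_rfl
          · rw [if_pos h, if_pos (not_lt.1 h)]
            exact mul_le_mul_of_nonneg_right (rho0_le_four _) (Real.log_natCast_nonneg p)
      _ = _ := by
          rw [theta_eq_sum_ite n (by positivity) (div_le_self hn0 (by linarith [(K.cast_nonneg : (0 : ℝ) ≤ K)])), mul_sum]
          exact congrArg _ (sum_congr rfl fun p _ => by split_ifs <;> simp)

/-- `ϑ(n/c)/n → 1/c` (prime number theorem `ϑ(x) ~ x`). [folklore] -/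
private theorem tendsto_theta_div {c : ℝ} (hc : 0 < c) :
    Tendsto (fun n : ℕ => Chebyshev.theta (n / c) / n) atTop (𝓝 (1 / c)) := by
  have h1 : Tendsto (fun x : ℝ => Chebyshev.theta x / x) atTop (𝓝 1) :=
    ((isEquivalent_iff_tendsto_one (eventually_ne_atTop 0)).1
      Literature.NumberTheory.LFunctions.chebyshevTheta_isEquivalent).congr fun x => rfl
  have h3 := (h1.comp (tendsto_natCast_atTop_atTop.atTop_div_const hc)).mul_const (1 / c)
  rw [one_mul] at h3
  refine h3.congr' ?_
  filter_upwards [eventually_gt_atTop 0] with n hn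
  have hn' : (0 : ℝ) < n := by exact_mod_cast hn
  simp only [Function.comp_def]; field_simp

/-- `(block sum of the mark a)/n → Σ_{k ≤ K} (1/(k+a) − 1/(k+1))`. [folklore] -/
private theorem tendsto_blockT_div {a : ℝ} (ha : 0 < a) (K : ℕ) :
    Tendsto (fun n : ℕ => (∑ i ∈ range K, (Chebyshev.theta (n / ((i : ℝ) + 1 + a)) - Chebyshev.theta (n / ((i : ℝ) + 2)))) / n)
      atTop (𝓝 (∑ i ∈ range K, (1 / ((i : ℝ) + 1 + a) - 1 / ((i : ℝ) + 2)))) := by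
  simp only [sum_div, sub_div]
  exact tendsto_finsetSum _ fun i _ =>
    (tendsto_theta_div (by positivity)).sub (tendsto_theta_div (by positivity))

/-- **Rivoal–Zudilin 2020, §6** (discharge of the named fact `log_phi_div_tendsto`): the limit
`δ = lim_n log(Φ_n)/n` exists and `1.2956 < δ < 1.2957` (printed: `δ = ∫₀¹ ρ₀(t) d(ψ(t)+t⁻¹) ≈ 1.29564`),
from the prime number theorem `ϑ(x) ~ x`. [cite: RivoalZudilin2020, §6 (arXiv:1803.03160 p. 10)] -/
theorem log_phi_div_tendsto_holds : log_phi_div_tendsto := by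
  -- the series `S_a` of the four marks (`δ = S₁ + S₂ + S₃ + S₄`) and the partial sums `δ_K`
  obtain ⟨hs1, hl1, hu1⟩ := mark_series (a := 1 / 3) (by norm_num) (by norm_num)
  obtain ⟨hs2, hl2, hu2⟩ := mark_series (a := 1 / 2) (by norm_num) (by norm_num)
  obtain ⟨hs3, hl3, hu3⟩ := mark_series (a := 2 / 3) (by norm_num) (by norm_num)
  obtain ⟨hs4, hl4, hu4⟩ := mark_series (a := 5 / 6) (by norm_num) (by norm_num)
  set S₁ : ℝ := ∑' i : ℕ, (1 / ((i : ℝ) + 1 + 1 / 3) - 1 / ((i : ℝ) + 2)) with hS₁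
  set S₂ : ℝ := ∑' i : ℕ, (1 / ((i : ℝ) + 1 + 1 / 2) - 1 / ((i : ℝ) + 2)) with hS₂
  set S₃ : ℝ := ∑' i : ℕ, (1 / ((i : ℝ) + 1 + 2 / 3) - 1 / ((i : ℝ) + 2)) with hS₃
  set S₄ : ℝ := ∑' i : ℕ, (1 / ((i : ℝ) + 1 + 5 / 6) - 1 / ((i : ℝ) + 2)) with hS₄
  set dP : ℕ → ℝ := fun K =>
    ∑ i ∈ range K, (1 / ((i : ℝ) + 1 + 1 / 3) - 1 / ((i : ℝ) + 2)) + ∑ i ∈ range K, (1 / ((i : ℝ) + 1 + 1 / 2) - 1 / ((i : ℝ) + 2)) +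
      ∑ i ∈ range K, (1 / ((i : ℝ) + 1 + 2 / 3) - 1 / ((i : ℝ) + 2)) + ∑ i ∈ range K, (1 / ((i : ℝ) + 1 + 5 / 6) - 1 / ((i : ℝ) + 2))
    with hdP_def
  have hdP : Tendsto dP atTop (𝓝 (S₁ + S₂ + S₃ + S₄)) :=
    ((hs1.tendsto_sum_tsum_nat.add hs2.tendsto_sum_tsum_nat).add hs3.tendsto_sum_tsum_nat).add
      hs4.tendsto_sum_tsum_nat
  refine ⟨S₁ + S₂ + S₃ + S₄, ?_, ?_, Metric.tendsto_atTop.2 fun ε hε => ?_⟩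
  · simp only [sum_range_succ, sum_range_zero] at hl1 hl2 hl3 hl4
    norm_num at hl1 hl2 hl3 hl4 ⊢
    linarith
  · simp only [sum_range_succ, sum_range_zero] at hu1 hu2 hu3 hu4
    norm_num at hu1 hu2 hu3 hu4 ⊢
    linarith
  -- `M_K(n)/n → δ_K` for every `K`
  set M : ℕ → ℕ → ℝ := fun n K =>
    ∑ p ∈ (Ioc 0 n).filter Nat.Prime, (if (n : ℝ) / (K + 1) < p then (rho0 (n / p) : ℝ) * Real.log p else 0) with hM
  have hMlim : ∀ K : ℕ, Tendsto (fun n : ℕ => M n K / n) atTop (𝓝 (dP K)) := fun K => by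
    simp only [hM, blockM_eq, add_div, hdP_def]
    exact (((tendsto_blockT_div (by norm_num) K).add (tendsto_blockT_div (by norm_num) K)).add
      (tendsto_blockT_div (by norm_num) K)).add (tendsto_blockT_div (by norm_num) K)
  have hε3 : 0 < ε / 3 := by positivity
  -- choose the depth `K`: `|δ_K − δ| < ε/3` and `4 log 4/(K+1) < ε/3`
  have hlim0 : Tendsto (fun K : ℕ => 4 * Real.log 4 / ((K : ℝ) + 1)) atTop (𝓝 0) :=
    tendsto_const_nhds.div_atTop (tendsto_atTop_add_const_right _ _ tendsto_natCast_atTop_atTop)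
  obtain ⟨K, hK1, hK2⟩ := (((Metric.tendsto_nhds.1 hdP) (ε / 3) hε3).and (hlim0.eventually (gt_mem_nhds hε3))).exists
  rw [Real.dist_eq] at hK1
  -- for this `K`, `M_K(n)/n` is eventually within `ε/3` of `δ_K`
  obtain ⟨N₁, hN₁⟩ := Metric.tendsto_atTop.1 (hMlim K) (ε / 3) hε3
  refine ⟨max N₁ (4 * (K + 1) ^ 2 + 1), fun n hn => ?_⟩
  have hn2 : 4 * (K + 1) ^ 2 ≤ n := by have := le_of_max_le_right hn; omega
  have hn' : (0 : ℝ) < n := by exact_mod_cast (show 0 < n by have := le_of_max_le_right hn; omega)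
  obtain ⟨hlo, hhi⟩ := sandwich n K hn2
  have hθ : Chebyshev.theta (n / ((K : ℝ) + 1)) ≤ Real.log 4 * (n / ((K : ℝ) + 1)) :=
    Chebyshev.theta_le_log4_mul_x (by positivity)
  specialize hN₁ n (le_of_max_le_left hn)
  rw [Real.dist_eq] at hN₁ ⊢
  have e1 : |Real.log (Phi n) / n - M n K / n| ≤ 4 * Real.log 4 / ((K : ℝ) + 1) := by
    rw [← sub_div, abs_div, abs_of_pos hn', div_le_iff₀ hn', abs_of_nonneg (by linarith)]
    calc Real.log (Phi n) - M n K ≤ 4 * (Real.log 4 * (n / ((K : ℝ) + 1))) := by linarith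
      _ = 4 * Real.log 4 / ((K : ℝ) + 1) * n := by ring
  calc |Real.log (Phi n) / n - (S₁ + S₂ + S₃ + S₄)|
      ≤ |Real.log (Phi n) / n - M n K / n| + |M n K / n - dP K| + |dP K - (S₁ + S₂ + S₃ + S₄)| := by
        linarith [abs_sub_le (Real.log (Phi n) / n) (M n K / n) (S₁ + S₂ + S₃ + S₄),
          abs_sub_le (M n K / n) (dP K) (S₁ + S₂ + S₃ + S₄)]
    _ < ε / 3 + ε / 3 + ε / 3 := by linarith
    _ = ε := by ring

end Literature.NumberTheory.Irrationality.RivoalZudilin2020
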